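import Summits.CriticalPhenomena.PercolationContinuityZ3.Theorems.PercNearOneGluingNoHeavyLowerTailKNGoodGMgcCert
import HarnessLib

/-!
# Bernoulli expectations `bexp`: dependence on bits, constants, and the split-point product rule (tools for the semantic layer)
# (`NoHeavyLowerTail` cell, stmt-CriticalPhenomena-4575; prover `prim-hp-2`, gen 17)

Support file (`--supports stmt-CriticalPhenomena-4575`).  One predicate (`DepOn`), no named facts, no sorries.
`KNGoodGMgc.bexp n f x` (`…KNGoodGMgcCert`) is the expectation of the integer function `f` of independent bits `C_i ~ Bernoulli(x i)`, `i < n`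
(bits `≥ n` read `false`), realised as `SBTens.eval n (ofFn n f) x`.  The semantic layer (gen-17 memo §4: world laws of pendant stars with inner
pairs, pattern laws) needs to compute such expectations STRUCTURALLY rather than by unfolding `2ⁿ` leaves.  This file provides:
* `DepOn P f` — `f` depends only on the bits `i` with `P i`;  `bexp_congr`;  `bexp_const`;
* `bexp_succ_of_dep` — a top bit the integrand ignores can be dropped;  `bexp_of_dep_lt` — all bits from `m` on;
* **`bexp_mul_split`** — if `f` depends only on bits `< m` and `g` only on bits `≥ m` then `bexp n (f·g) = bexp m f · bexp n g` (`m ≤ n`):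
  independence of disjoint blocks of bits (the three stars `x, y, z` and the pairs occupy the contiguous blocks `0–2, 3–5, 6–8, 9–11`).
-/

namespace Summit.CriticalPhenomena.PercolationContinuityZ3.Theorems

namespace KNGoodGMgc

open SBTens

/-- `f` depends only on the bits selected by `P`. [folklore] -/
def DepOn (P : ℕ → Prop) (f : Cfg → ℤ) : Prop := ∀ c c' : Cfg, (∀ i, P i → c i = c' i) → f c = f c'

/-- Expectations of pointwise equal integrands agree. [folklore] -/
theorem bexp_congr (n : ℕ) {f g : Cfg → ℤ} (h : ∀ c, f c = g c) (x : ℕ → ℝ) : bexp n f x = bexp n g x := by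
  have : f = g := funext h
  rw [this]

/-- Expectation of a constant. [folklore] -/
theorem bexp_const : ∀ (n : ℕ) (k : ℤ) (x : ℕ → ℝ), bexp n (fun _ => k) x = (k : ℝ)
  | 0, k, x => by rw [bexp_zero]
  | n + 1, k, x => by rw [bexp_succ, bexp_const n k x]; ring

/-- A top bit the integrand does not read can be dropped. [folklore] -/
theorem bexp_succ_of_dep (n : ℕ) (f : Cfg → ℤ) (hf : DepOn (fun i => i ≠ n) f) (x : ℕ → ℝ) :
    bexp (n + 1) f x = bexp n f x := by
  have h0 : (fun c => f (Function.update c n false)) = f := by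
    funext c; apply hf; intro i hi; simp [Function.update_of_ne hi]
  have h1 : (fun c => f (Function.update c n true)) = f := by
    funext c; apply hf; intro i hi; simp [Function.update_of_ne hi]
  rw [bexp_succ, h0, h1]; ring

/-- If `f` reads only bits `< m` then `bexp n f = bexp m f` for every `n ≥ m`. [folklore] -/
theorem bexp_of_dep_lt (m : ℕ) (f : Cfg → ℤ) (hf : DepOn (fun i => i < m) f) : ∀ n, m ≤ n → ∀ x, bexp n f x = bexp m f x
  | 0, h, x => by have : m = 0 := Nat.le_zero.1 h; subst this; rfl
  | n + 1, h, x => by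
    rcases Nat.eq_or_lt_of_le h with h1 | h1
    · rw [h1]
    · have hmn : m ≤ n := Nat.lt_succ_iff.1 h1
      rw [bexp_succ_of_dep n f (fun c c' hcc' => hf c c' fun i hi => hcc' i (Nat.ne_of_lt (lt_of_lt_of_le hi hmn))) x]
      exact bexp_of_dep_lt m f hf n hmn x

/-- Dependence on fewer bits is dependence on more bits. [folklore] -/
theorem DepOn.mono {P P' : ℕ → Prop} {g : Cfg → ℤ} (h : ∀ i, P i → P' i) (hg : DepOn P g) : DepOn P' g :=
  fun c c' hcc' => hg c c' fun i hi => hcc' i (h i hi)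

/-- An integrand reading only bits `≥ m ≥ n` is constant under `bexp n` (those bits are `false`). [folklore] -/
theorem bexp_of_dep_ge : ∀ (n m : ℕ) (g : Cfg → ℤ), n ≤ m → DepOn (fun i => m ≤ i) g → ∀ x, bexp n g x = (g (fun _ => false) : ℝ)
  | 0, m, g, _, _, x => by rw [bexp_zero]
  | n + 1, m, g, hmn, hg, x => by
    have hdep : DepOn (fun i => i ≠ n) g := fun c c' h => hg c c' fun i hi => h i (by omega)
    rw [bexp_succ_of_dep n g hdep x]
    exact bexp_of_dep_ge n m g (by omega) hg x

/-- A factor reading only bits `≥ n` comes out of `bexp n` as its value at the all-`false` configuration. [folklore] -/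
theorem bexp_mul_of_dep_ge : ∀ (n : ℕ) (f g : Cfg → ℤ), DepOn (fun i => n ≤ i) g → ∀ x,
    bexp n (fun c => f c * g c) x = bexp n f x * (g (fun _ => false) : ℝ)
  | 0, f, g, _, x => by rw [bexp_zero, bexp_zero]; push_cast; ring
  | n + 1, f, g, hg, x => by
    have hgn : ∀ c b, g (Function.update c n b) = g c := fun c b =>
      hg _ _ fun i hi => by
        have hin : i ≠ n := by omega
        simp [Function.update_of_ne hin]
    rw [bexp_succ, bexp_succ]
    have e : ∀ b, (fun c => f (Function.update c n b) * g (Function.update c n b)) = fun c => f (Function.update c n b) * g c := by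
      intro b; funext c; rw [hgn c b]
    rw [e false, e true, bexp_mul_of_dep_ge n _ g (DepOn.mono (fun i hi => by omega) hg) x,
      bexp_mul_of_dep_ge n _ g (DepOn.mono (fun i hi => by omega) hg) x]
    ring

/-- **Split-point product rule.**  If `f` reads only bits `< m` and `g` only bits `≥ m`, then for `n ≥ m`
`bexp n (f·g) = bexp m f · bexp n g` (independence of disjoint blocks of Bernoulli bits). [folklore] -/
theorem bexp_mul_split (m : ℕ) (f g : Cfg → ℤ) (hf : DepOn (fun i => i < m) f) :
    ∀ n, m ≤ n → DepOn (fun i => m ≤ i) g → ∀ x, bexp n (fun c => f c * g c) x = bexp m f x * bexp n g x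
  | 0, h, hg, x => by
    have : m = 0 := Nat.le_zero.1 h
    subst this
    rw [bexp_zero, bexp_zero, bexp_zero]; push_cast; ring
  | n + 1, h, hg, x => by
    rcases Nat.eq_or_lt_of_le h with h1 | h1
    · rw [h1, bexp_mul_of_dep_ge (n + 1) f g (h1 ▸ hg) x, bexp_of_dep_ge (n + 1) (n + 1) g le_rfl (h1 ▸ hg) x]
    · have hmn : m ≤ n := Nat.lt_succ_iff.1 h1
      rw [bexp_succ, bexp_succ n g]
      have hf' : ∀ b, (fun c => f (Function.update c n b) * g (Function.update c n b)) = fun c => f c * g (Function.update c n b) := by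
        intro b; funext c
        rw [hf (Function.update c n b) c fun i hi => by simp [Function.update_of_ne (Nat.ne_of_lt (lt_of_lt_of_le hi hmn))]]
      have hg' : ∀ b, DepOn (fun i => m ≤ i) (fun c => g (Function.update c n b)) := fun b c c' hcc' =>
        hg _ _ fun i hi => by
          by_cases hin : i = n
          · subst hin; simp
          · simp only [Function.update_of_ne hin]; exact hcc' i hi
      rw [hf' false, hf' true, bexp_mul_split m f _ hf n hmn (hg' false) x, bexp_mul_split m f _ hf n hmn (hg' true) x]
      ring

/-- **Disjoint-support product rule.**  If `f` reads only bits in `S`, `g` only bits in `T`, and no bit is in both, then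
`bexp n (f·g) = bexp n f · bexp n g` (independence of disjoint families of Bernoulli bits; the supports need not be intervals — e.g. the
merged star `[xy]` reads bits `{a, a+3}` per relay). [folklore] -/
theorem bexp_mul_disjoint (S T : ℕ → Prop) (hST : ∀ i, ¬(S i ∧ T i)) :
    ∀ (n : ℕ) (f g : Cfg → ℤ), DepOn S f → DepOn T g → ∀ x, bexp n (fun c => f c * g c) x = bexp n f x * bexp n g x
  | 0, f, g, _, _, x => by rw [bexp_zero, bexp_zero, bexp_zero]; push_cast; ring
  | n + 1, f, g, hf, hg, x => by
    by_cases hS : S n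
    · -- `g` ignores bit `n`
      have hTn : ¬T n := fun hT => hST n ⟨hS, hT⟩
      have hgn : ∀ c b, g (Function.update c n b) = g c := fun c b =>
        hg _ _ fun i hi => by
          have hin : i ≠ n := fun h => hTn (h ▸ hi)
          simp [Function.update_of_ne hin]
      have hf' : ∀ b, DepOn S (fun c => f (Function.update c n b)) := fun b c c' hcc' =>
        hf _ _ fun i hi => by
          by_cases hin : i = n
          · subst hin; simp
          · simp only [Function.update_of_ne hin]; exact hcc' i hi
      rw [bexp_succ, bexp_succ n f, bexp_succ_of_dep n g (fun c c' h => hg c c' fun i hi => h i (fun e => hTn (e ▸ hi))) x]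
      have e : ∀ b, (fun c => f (Function.update c n b) * g (Function.update c n b)) = fun c => f (Function.update c n b) * g c := by
        intro b; funext c; rw [hgn c b]
      rw [e false, e true, bexp_mul_disjoint S T hST n _ g (hf' false) hg x, bexp_mul_disjoint S T hST n _ g (hf' true) hg x]
      ring
    · -- `f` ignores bit `n`
      have hfn : ∀ c b, f (Function.update c n b) = f c := fun c b =>
        hf _ _ fun i hi => by
          have hin : i ≠ n := fun h => hS (h ▸ hi)
          simp [Function.update_of_ne hin]
      have hg' : ∀ b, DepOn T (fun c => g (Function.update c n b)) := fun b c c' hcc' =>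
        hg _ _ fun i hi => by
          by_cases hin : i = n
          · subst hin; simp
          · simp only [Function.update_of_ne hin]; exact hcc' i hi
      rw [bexp_succ, bexp_succ n g, bexp_succ_of_dep n f (fun c c' h => hf c c' fun i hi => h i (fun e => hS (e ▸ hi))) x]
      have e : ∀ b, (fun c => f (Function.update c n b) * g (Function.update c n b)) = fun c => f c * g (Function.update c n b) := by
        intro b; funext c; rw [hfn c b]
      rw [e false, e true, bexp_mul_disjoint S T hST n f _ hf (hg' false) x, bexp_mul_disjoint S T hST n f _ hf (hg' true) x]
      ring

end KNGoodGMgc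

end Summit.CriticalPhenomena.PercolationContinuityZ3.Theorems
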